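import Mathlib
import Summits.AtomisticToContinuum.BoseEinsteinCondensation.Theses.BECStronglyRayleigh

/-!
# Sketch — crux-ideate stmt-AtomisticToContinuum-9673 (InsertionFieldDelocalisation), ideator 1, round 1

First-lemma signatures of the idea cards (they need not be proved here; they must elaborate):

* `SectorEnergyConvexityGraph` / `SectorEnergyConvexityTorus` — card `mobile-trap-dirichlet-eigenfunction`
  and card `grand-canonical-stability-convexity`: sector ground energies of kinetically dominated hard-core
  bosons (XXZ, `|Δ| ≤ 1`, ferro-XY sign, arbitrary fields) are CONVEX in the particle number.
* `ChemicalPotentialExcessBound` — corollary on the XY torus: `δ_N = E(N) − E(N−1) + 3 ≤ 12 N / L³`.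
* `OverlapContactIdentity` — the exact identity behind the two-body embedding:
  `⟨ψ_{N−1}, R⟩ · δ_N = ⟨ψ_{N−1}, ξ⟩` (one-particle insertion total `R`, contact insertion field `ξ`).
* `CoshBudgetIdentity` — card `cosh-budget-penrose-onsager`: for EVERY positive trial amplitude `Φ` on
  `N`-sets, `Σ_{directed token edges} Φ(S)Φ(S') cosh(∇log φ − ∇log Φ) = −2 E(N) Σ_S Φ(S)²`.
-/

namespace Summit.AtomisticToContinuum.BoseEinsteinCondensation.Cruxes.InsertionFieldDelocalisation.Ideator1

open scoped BigOperators
open Literature.MathematicalPhysics.QuantumLattice Literature.Probability.LatticeModels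

/-- Convexity of sector energies in the particle number, general graph, `|Δ| ≤ 1`, arbitrary on-site fields
(occupied = spin up; `N` up spins ↔ magnetisation `N − |Λ|/2`). -/
def SectorEnergyConvexityGraph : Prop :=
  ∀ (Λ : Type) [Fintype Λ] [DecidableEq Λ] (G : SimpleGraph Λ) [DecidableRel G.Adj], G.Connected →
    ∀ (Δ : ℝ) (μ : Λ → ℝ), |Δ| ≤ 1 → ∀ N : ℕ, 1 ≤ N → N + 1 ≤ Fintype.card Λ →
      let H := xxzHamiltonian 1 G (-1) Δ + ∑ x : Λ, ((μ x : ℝ) : ℂ) • siteSpin 1 x 2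
      let E : ℕ → ℝ := fun k => lowestEnergyInSector 1 H ((k : ℝ) - (Fintype.card Λ : ℝ) / 2)
      2 * E N ≤ E (N + 1) + E (N - 1)

/-- The torus / pure-hopping specialisation used by the crux (`xyTorus 3 L 1`, `Δ = 0`, no field). -/
def SectorEnergyConvexityTorus : Prop :=
  ∀ (L : ℕ) [NeZero L], 2 ≤ L → ∀ N : ℕ, 1 ≤ N → N + 1 ≤ L ^ 3 →
    let E : ℕ → ℝ := fun k => lowestEnergyInSector 1 (xyTorus 3 L 1) ((k : ℝ) - (L : ℝ) ^ 3 / 2)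
    2 * E N ≤ E (N + 1) + E (N - 1)

/-- Chemical-potential excess (= annealed trapping rate of the inserted particle) is `O(ν)` at every filling
`≤ ½`: `E(N) − E(N−1) + 3 ≤ 12 N / L³` (from convexity, `E(N) ≥ −3N`, the flat-state bound on `E(2N)`, and
particle–hole symmetry `E(N) = E(L³ − N)`). -/
def ChemicalPotentialExcessBound : Prop :=
  ∀ (L : ℕ) [NeZero L], 2 ≤ L → ∀ N : ℕ, 2 ≤ N → 2 * N ≤ L ^ 3 →
    let E : ℕ → ℝ := fun k => lowestEnergyInSector 1 (xyTorus 3 L 1) ((k : ℝ) - (L : ℝ) ^ 3 / 2)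
    E N - E (N - 1) + 3 ≤ 12 * (N : ℝ) / (L : ℝ) ^ 3

/-- The exact identity behind the two-body (background ⊗ tagged particle) embedding: for the positive sector
ground vectors `ψ` (N bosons) and `ψ'` (N−1 bosons) of the XY torus (`L ≥ 3`, coordination 6), with
`φ(S) = Re ψ(1_S)`, `φ'(T) = Re ψ'(1_T)`, one-particle insertion total `R_T = Σ_{x∉T} φ(T ∪ x)` and contact
insertion field `ξ_T = Σ_{x∉T} #{y ∼ x : y ∈ T} · φ(T ∪ x)`:
`(E(N) − E(N−1) + 3) · Σ_T φ'(T) R_T = Σ_T φ'(T) ξ_T`. -/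
def OverlapContactIdentity : Prop :=
  ∀ (L : ℕ) [NeZero L], 3 ≤ L → ∀ N : ℕ, 2 ≤ N → N ≤ L ^ 3 →
    ∀ ψ ψ' : TensorIndex (TorusSite 3 L) 2 → ℂ,
      ψ ∈ spinZSector 1 ((N : ℝ) - (L : ℝ) ^ 3 / 2) → ψ ≠ 0 →
      (xyTorus 3 L 1).mulVec ψ = ((lowestEnergyInSector 1 (xyTorus 3 L 1) ((N : ℝ) - (L : ℝ) ^ 3 / 2) : ℝ) : ℂ) • ψ →
      ψ' ∈ spinZSector 1 (((N : ℝ) - 1) - (L : ℝ) ^ 3 / 2) → ψ' ≠ 0 →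
      (xyTorus 3 L 1).mulVec ψ' = ((lowestEnergyInSector 1 (xyTorus 3 L 1) (((N : ℝ) - 1) - (L : ℝ) ^ 3 / 2) : ℝ) : ℂ) • ψ' →
      let φ : Finset (TorusSite 3 L) → ℝ := fun S => (ψ (fun x => if x ∈ S then 0 else 1)).re
      let φ' : Finset (TorusSite 3 L) → ℝ := fun S => (ψ' (fun x => if x ∈ S then 0 else 1)).re
      let R : Finset (TorusSite 3 L) → ℝ := fun T => ∑ x, (if x ∉ T then φ (insert x T) else 0)
      let ξ : Finset (TorusSite 3 L) → ℝ := fun T =>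
        ∑ x, (if x ∉ T then (((T.filter fun y => (torusGraph 3 L).Adj x y).card : ℕ) : ℝ) * φ (insert x T) else 0)
      let E : ℕ → ℝ := fun k => lowestEnergyInSector 1 (xyTorus 3 L 1) ((k : ℝ) - (L : ℝ) ^ 3 / 2)
      (E N - E (N - 1) + 3) * ∑ T ∈ (Finset.univ : Finset (TorusSite 3 L)).powersetCard (N - 1), φ' T * R T
        = ∑ T ∈ (Finset.univ : Finset (TorusSite 3 L)).powersetCard (N - 1), φ' T * ξ T

/-- The cosh-budget identity: for the positive sector-N ground amplitude `φ` and ANY trial amplitude `Φ`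
positive on N-sets, the `Φ ⊗ Φ`-weighted exponential discrepancy of `log φ − log Φ` over directed token-graph
edges `S → S − a + b` (`a ∈ S`, `b ∉ S`, `a ∼ b`) equals `−2 E(N) ‖Φ‖²`; subtracting the same identity for
`φ = Φ`-terms gives `Σ_edges ΦΦ' [cosh(∇(log φ − log Φ)) − 1] = (E_Φ − E(N)) ‖Φ‖²`, the variational excess. -/
def CoshBudgetIdentity : Prop :=
  ∀ (L : ℕ) [NeZero L], 2 ≤ L → ∀ N : ℕ, 1 ≤ N → N ≤ L ^ 3 →
    ∀ ψ : TensorIndex (TorusSite 3 L) 2 → ℂ,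
      ψ ∈ spinZSector 1 ((N : ℝ) - (L : ℝ) ^ 3 / 2) →
      (xyTorus 3 L 1).mulVec ψ = ((lowestEnergyInSector 1 (xyTorus 3 L 1) ((N : ℝ) - (L : ℝ) ^ 3 / 2) : ℝ) : ℂ) • ψ →
      let φ : Finset (TorusSite 3 L) → ℝ := fun S => (ψ (fun x => if x ∈ S then 0 else 1)).re
      (∀ S : Finset (TorusSite 3 L), S.card = N → 0 < φ S) →
      ∀ Φ : Finset (TorusSite 3 L) → ℝ, (∀ S : Finset (TorusSite 3 L), S.card = N → 0 < Φ S) →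
        ∑ S ∈ (Finset.univ : Finset (TorusSite 3 L)).powersetCard N, ∑ a ∈ S, ∑ b,
            (if b ∉ S ∧ (torusGraph 3 L).Adj a b then
              Φ S * Φ (insert b (S.erase a)) *
                Real.cosh (Real.log (φ (insert b (S.erase a))) - Real.log (φ S)
                  - Real.log (Φ (insert b (S.erase a))) + Real.log (Φ S))
            else 0)
          = -2 * lowestEnergyInSector 1 (xyTorus 3 L 1) ((N : ℝ) - (L : ℝ) ^ 3 / 2)
              * ∑ S ∈ (Finset.univ : Finset (TorusSite 3 L)).powersetCard N, Φ S ^ 2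

/-- Physical nearest-neighbour ANTIBUNCHING in the sector ground state (pair-level fragment of the v2 card's
conjecture P, proved by concavity of `Δ ↦ E(Δ)` + the exact ferromagnetic energy at `Δ = 1` + Hellmann–Feynman):
for the normalised sector-N ground vector `ψ` of the XY torus, `Σ_{x∼y} ⟨ψ, n_x n_y ψ⟩ ≤ 2 (E(N) + 3N)`
(ordered pairs; `n_x = S³_x + ½`; the right side is `2 E_π[b] ≤ 6N(N−1)/(L³−1)`, the amplitude-measure value). -/
def PhysicalAntibunching : Prop :=
  ∀ (L : ℕ) [NeZero L], 3 ≤ L → ∀ N : ℕ, N ≤ L ^ 3 →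
    ∀ ψ : TensorIndex (TorusSite 3 L) 2 → ℂ,
      ψ ∈ spinZSector 1 ((N : ℝ) - (L : ℝ) ^ 3 / 2) → star ψ ⬝ᵥ ψ = 1 →
      (xyTorus 3 L 1).mulVec ψ = ((lowestEnergyInSector 1 (xyTorus 3 L 1) ((N : ℝ) - (L : ℝ) ^ 3 / 2) : ℝ) : ℂ) • ψ →
      (∑ x : TorusSite 3 L, ∑ y : TorusSite 3 L,
          (if (torusGraph 3 L).Adj x y then
            (star ψ ⬝ᵥ ((siteSpin 1 x 2 + (1 / 2 : ℂ) • 1) * (siteSpin 1 y 2 + (1 / 2 : ℂ) • 1)).mulVec ψ).re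
          else 0))
        ≤ 2 * (lowestEnergyInSector 1 (xyTorus 3 L 1) ((N : ℝ) - (L : ℝ) ^ 3 / 2) + 3 * N)

/-- The Penrose–Onsager trial state `Φ = a₀† ψ'` (insert one zero-momentum boson into the (N−1)-ground state,
hard core respected) has TOTAL variational excess `O(ν)`: `⟨Φ, H Φ⟩ ≤ (E(N) + C N/L³) ⟨Φ, Φ⟩` with one constant
`C` for all `L`, all `2 ≤ N ≤ L³/2` (card `cosh-budget-penrose-onsager`, step B2; proof: exact commutator algebra,
`⟨R, ξ⟩ ≤ δ_N ‖R‖²`, `ChemicalPotentialExcessBound`). Occupied = Fin-index 0. -/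
def POTrialExcessBound : Prop :=
  ∃ C : ℝ, ∀ (L : ℕ) [NeZero L], 3 ≤ L → ∀ N : ℕ, 2 ≤ N → 2 * N ≤ L ^ 3 →
    ∀ ψ' : TensorIndex (TorusSite 3 L) 2 → ℂ,
      ψ' ∈ spinZSector 1 (((N : ℝ) - 1) - (L : ℝ) ^ 3 / 2) → ψ' ≠ 0 →
      (xyTorus 3 L 1).mulVec ψ' = ((lowestEnergyInSector 1 (xyTorus 3 L 1) (((N : ℝ) - 1) - (L : ℝ) ^ 3 / 2) : ℝ) : ℂ) • ψ' →
      (∀ σ, 0 ≤ (ψ' σ).re ∧ (ψ' σ).im = 0) →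
      let Φ : TensorIndex (TorusSite 3 L) 2 → ℂ :=
        fun σ => ∑ x : TorusSite 3 L, (if σ x = 0 then ψ' (Function.update σ x 1) else 0)
      (star Φ ⬝ᵥ (xyTorus 3 L 1).mulVec Φ).re
        ≤ (lowestEnergyInSector 1 (xyTorus 3 L 1) ((N : ℝ) - (L : ℝ) ^ 3 / 2) + C * (N : ℝ) / (L : ℝ) ^ 3)
            * (star Φ ⬝ᵥ Φ).re

/-- The convexity lemma feeds the crux only through `ChemicalPotentialExcessBound`; record the intended
implication as a statement (proof: telescoping + variational bounds, see card). -/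
def ConvexityGivesExcessBound : Prop :=
  SectorEnergyConvexityTorus → ChemicalPotentialExcessBound

end Summit.AtomisticToContinuum.BoseEinsteinCondensation.Cruxes.InsertionFieldDelocalisation.Ideator1
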